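import Mathlib
import Literature.Computability.Complexity.RangeAvoidance
import Literature.Computability.Complexity.SignDegreeXor
import Summits.PneNP.PneNP.Theorems.PstarSASDPLevel
import Summits.PneNP.PneNP.Theorems.PstarTyped
import Summits.PneNP.PneNP.Theorems.PstarExpandingModel
import Summits.PneNP.PneNP.Theorems.PstarExpandingCount
import Summits.PneNP.PneNP.Theorems.PstarExpandingExist
import Summits.PneNP.PneNP.Theorems.PstarDensityCount
import Summits.PneNP.PneNP.Theorems.SASubThreshold

/-!
# Density-uniform expanding typed `P⋆` instances, II: the estimate and T23.1-B `PstarExpandingDensity` (cell `pnp-ideate`, ROUND-23)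

FRONTIER range-avoidance ladder, rung F-N3 context (restricted-model combinatorics; nothing here bears on `P` vs `NP`).
Closes `SASubThreshold.PstarExpandingDensity` BY NAME (`pstarExpandingDensity`): for every `t ≥ 2` there is `c > 0`
(`c = 1944^{2t}·6^{t−1}`) such that for every density `Δ ≥ 1` and every `N₀` some typed pure-`P⋆` instance on `n = 2N ≥ N₀`
variables with exactly `Δ·n` outputs is `(r, (t+1)/t)`-boundary expanding for EVERY radius `r` with `c·Δ^{2t}·r^{t−1} ≤ n^{t−1}`.
First moment over the ROUND-21 model (`PstarExpandingModel`, union bound `PstarDensityCount.card_badSetT_le`):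
* `termT_le` — the DENSITY-UNIFORM TERM ESTIMATE `C(m,f)·C(2N, v)·(v⁴/(4N⁴))^f ≤ 2^{−f}` (`v = vT t f`, `m ≤ 2ΔN`) under
  `(1944Δ)^{2t}·(3f)^{t−1} ≤ N^{t−1}`: after `PstarExpandingExist.key_identity` the term is `≤ (972Δ)^f·(3f/N)^q` with the slack
  `2t·q ≥ (t−1)·f` (`PstarDensityCount.slack_le`); the comparison is done at the `2t`-th POWER so that all exponents stay natural
  numbers (`(3f/N)^{2tq} ≤ (3f/N)^{(t−1)f}`), and the `2t`-th root is taken with `pow_le_pow_iff_left₀`;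
* `card_badSetT_lt`, `exists_goodT` — fewer bad outcomes than outcomes;
* `pstarExpandingDensity` — the instance is chosen good at the LARGEST admissible radius (`Nat.findGreatest`) and expansion is
  handed down to every admissible `r` by monotonicity (`badT_mono`); `n = N + N`, `(N+N)^{t−1} = 2^{t−1}N^{t−1}` absorbs into `c`.
With the hub `PairwiseSA.pairwiseSALinearLevel` and `PstarTypedLaws.typedPairwiseLaws` this feeds
`SASubThreshold.pstarSASubThresholdBlind_of` (HEADLINE-23-B).
-/

set_option linter.dupNamespace false

open Finset Literature.Computability.Complexity
open Summit.PneNP.PneNP.Theorems.PstarSASDPLevel (BoundaryExpandingQ)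
open Summit.PneNP.PneNP.Theorems.PstarTyped (Typed)
open Summit.PneNP.PneNP.Theorems.PstarExpandingModel
open Summit.PneNP.PneNP.Theorems.PstarExpandingExist (choose_le key_identity geom_half_lt_one)
open Summit.PneNP.PneNP.Theorems.PstarDensityCount

namespace Summit.PneNP.PneNP.Theorems.PstarDensityExist

variable {N m : ℕ}

/-! ## Arithmetic of the radius condition -/

/-- The radius condition forces `3r ≤ N` (for `t ≥ 2`, `Δ ≥ 1`). -/
theorem three_mul_le_of_hyp {t Δ N r : ℕ} (ht : 2 ≤ t) (hΔ : 1 ≤ Δ)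
    (hH : (1944 * Δ) ^ (2 * t) * (3 * r) ^ (t - 1) ≤ N ^ (t - 1)) : 3 * r ≤ N := by
  have h1 : 1 ≤ (1944 * Δ) ^ (2 * t) := Nat.one_le_pow _ _ (by omega)
  have h2 : (3 * r) ^ (t - 1) ≤ N ^ (t - 1) := le_trans (Nat.le_mul_of_pos_left _ h1) hH
  exact (Nat.pow_le_pow_iff_left (by omega)).1 h2

/-- `1 ≤ vT t f` for `t, f ≥ 1`. -/
theorem one_le_vT {t f : ℕ} (ht : 1 ≤ t) (hf : 1 ≤ f) : 1 ≤ vT t f := by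
  unfold vT
  rw [Nat.le_div_iff_mul_le (by omega)]
  have : 5 * t + 1 ≤ (5 * t + 1) * f := Nat.le_mul_of_pos_right _ hf
  omega

/-! ## The term estimate -/

/-- **The density-uniform term estimate.**  For `t, f ≥ 1`, `m ≤ 2ΔN`, `3f ≤ N` and `(1944Δ)^{2t}(3f)^{t−1} ≤ N^{t−1}`:
`C(m,f)·C(2N, vT t f)·((vT t f)⁴/(4N⁴))^f ≤ 2^{−f}`. -/
theorem termT_le (t Δ N f m : ℕ) (ht : 1 ≤ t) (hf : 1 ≤ f) (hm : m ≤ 2 * Δ * N)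
    (hH : (1944 * Δ) ^ (2 * t) * (3 * f) ^ (t - 1) ≤ N ^ (t - 1)) (h3f : 3 * f ≤ N) :
    (m.choose f : ℝ) * ((N + N).choose (vT t f) : ℝ) * (((vT t f : ℕ) : ℝ) ^ 4 / (4 * (N : ℝ) ^ 4)) ^ f ≤
      (1 / 2) ^ f := by
  set v := vT t f with hvdef
  set q := 3 * f - v with hqdef
  have hv3 : v ≤ 3 * f := vT_le t f ht
  have hvq : v + q = 3 * f := by omega
  have hv1 : 1 ≤ v := one_le_vT ht hf
  have hslack : (t - 1) * f ≤ 2 * t * q := slack_le t f ht hf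
  have hN1 : 1 ≤ N := by omega
  -- real versions
  have hfR : (0 : ℝ) < f := by exact_mod_cast hf
  have hvR : (0 : ℝ) < v := by exact_mod_cast hv1
  have hNR : (0 : ℝ) < N := by exact_mod_cast hN1
  have hΔR : (0 : ℝ) ≤ Δ := by positivity
  -- Step 1: the two binomials
  have hA : (m.choose f : ℝ) ≤ (3 * (2 * Δ) * N / f) ^ f := by
    refine (choose_le m f hf).trans (pow_le_pow_left₀ (by positivity) ?_ _)
    have : (m : ℝ) ≤ 2 * Δ * N := by exact_mod_cast hm
    rw [div_le_div_iff_of_pos_right hfR]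
    linarith
  have hB : ((N + N).choose v : ℝ) ≤ (6 * N / v) ^ v := by
    refine (choose_le (N + N) v hv1).trans (le_of_eq ?_)
    push_cast; ring
  -- Step 2: combine and rewrite
  have hE : (m.choose f : ℝ) * ((N + N).choose v : ℝ) * ((v : ℝ) ^ 4 / (4 * (N : ℝ) ^ 4)) ^ f ≤
      (3 * (2 * Δ) * N / f) ^ f * (6 * N / v) ^ v * ((v : ℝ) ^ 4 / (4 * (N : ℝ) ^ 4)) ^ f := by
    have h0 : (0 : ℝ) ≤ ((v : ℝ) ^ 4 / (4 * (N : ℝ) ^ 4)) ^ f := by positivity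
    exact mul_le_mul_of_nonneg_right (mul_le_mul hA hB (by positivity) (by positivity)) h0
  rw [key_identity (2 * Δ) N v f hfR.ne' hvR.ne' hNR.ne' f v q (by omega)] at hE
  refine hE.trans ?_
  -- Step 3: bound by `(972Δ)^f · x^q`, `x = 3f/N`
  set x : ℝ := 3 * (f : ℝ) / N with hxdef
  have hx0 : 0 ≤ x := by positivity
  have hx1 : x ≤ 1 := by
    rw [hxdef, div_le_one hNR]
    exact_mod_cast h3f
  have f1 : (3 * (2 * Δ) * v / (4 * f) : ℝ) ^ f ≤ (9 * Δ / 2) ^ f := by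
    refine pow_le_pow_left₀ (by positivity) ?_ _
    rw [div_le_div_iff₀ (by positivity) (by positivity)]
    have : (v : ℝ) ≤ 3 * f := by exact_mod_cast hv3
    nlinarith
  have f2 : (6 : ℝ) ^ v ≤ 216 ^ f := by
    calc (6 : ℝ) ^ v ≤ 6 ^ (3 * f) := pow_le_pow_right₀ (by norm_num) hv3
      _ = 216 ^ f := by rw [pow_mul]; norm_num
  have f3 : ((v : ℝ) / N) ^ q ≤ x ^ q := by
    refine pow_le_pow_left₀ (by positivity) ?_ _
    rw [hxdef, div_le_div_iff_of_pos_right hNR]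
    exact_mod_cast hv3
  have hU : (3 * (2 * Δ) * v / (4 * f) : ℝ) ^ f * 6 ^ v * ((v : ℝ) / N) ^ q ≤ (972 * Δ) ^ f * x ^ q := by
    have h := mul_le_mul (mul_le_mul f1 f2 (by positivity) (by positivity)) f3 (by positivity) (by positivity)
    refine h.trans (le_of_eq ?_)
    rw [← mul_pow]
    ring
  refine hU.trans ?_
  -- Step 4: compare `2t`-th powers
  have h2t : 2 * t ≠ 0 := by omega
  rw [← pow_le_pow_iff_left₀ (by positivity) (by positivity) h2t]
  have hbase : ((972 : ℝ) * Δ) ^ (2 * t) * x ^ (t - 1) ≤ ((1 : ℝ) / 2) ^ (2 * t) := by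
    have hHR : ((1944 : ℝ) * Δ) ^ (2 * t) * (3 * (f : ℝ)) ^ (t - 1) ≤ (N : ℝ) ^ (t - 1) := by exact_mod_cast hH
    rw [hxdef, div_pow, ← mul_div_assoc, div_le_iff₀ (by positivity), div_pow, one_pow,
      div_mul_eq_mul_div, le_div_iff₀ (by positivity)]
    calc ((972 : ℝ) * Δ) ^ (2 * t) * (3 * (f : ℝ)) ^ (t - 1) * 2 ^ (2 * t)
        = ((1944 : ℝ) * Δ) ^ (2 * t) * (3 * (f : ℝ)) ^ (t - 1) := by
          rw [show (1944 : ℝ) * Δ = 972 * Δ * 2 by ring, mul_pow (972 * (Δ : ℝ)) 2]; ring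
      _ ≤ (N : ℝ) ^ (t - 1) := hHR
      _ = 1 * (N : ℝ) ^ (t - 1) := (one_mul _).symm
  calc (((972 : ℝ) * Δ) ^ f * x ^ q) ^ (2 * t)
      = ((972 : ℝ) * Δ) ^ (2 * t * f) * x ^ (2 * t * q) := by
        rw [mul_pow, ← pow_mul, ← pow_mul, Nat.mul_comm f, Nat.mul_comm q]
    _ ≤ ((972 : ℝ) * Δ) ^ (2 * t * f) * x ^ ((t - 1) * f) :=
        mul_le_mul_of_nonneg_left (pow_le_pow_of_le_one hx0 hx1 hslack) (by positivity)
    _ = (((972 : ℝ) * Δ) ^ (2 * t) * x ^ (t - 1)) ^ f := by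
        rw [mul_pow (((972 : ℝ) * Δ) ^ (2 * t)) (x ^ (t - 1)) f, ← pow_mul, ← pow_mul]
    _ ≤ (((1 : ℝ) / 2) ^ (2 * t)) ^ f := pow_le_pow_left₀ (by positivity) hbase _
    _ = (((1 : ℝ) / 2) ^ f) ^ (2 * t) := by rw [← pow_mul, ← pow_mul, Nat.mul_comm]

/-! ## Existence -/

/-- **Good outcomes are rarer than outcomes**: for `t ≥ 2`, `Δ ≥ 1`, `N ≥ 2` and a radius `r` with
`(1944Δ)^{2t}(3r)^{t−1} ≤ N^{t−1}`, fewer outcomes with `Δ·2N` outputs are bad than there are outcomes. -/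
theorem card_badSetT_lt (t Δ N r : ℕ) (ht : 2 ≤ t) (hΔ : 1 ≤ Δ) (hN : 2 ≤ N)
    (hH : (1944 * Δ) ^ (2 * t) * (3 * r) ^ (t - 1) ≤ N ^ (t - 1)) :
    ((badSetT N (Δ * (N + N)) t r).card : ℝ) < (Fintype.card (Outcome N (Δ * (N + N))) : ℝ) := by
  set m := Δ * (N + N) with hmdef
  have hm : m ≤ 2 * Δ * N := le_of_eq (by rw [hmdef]; ring)
  have ht1 : 1 ≤ t := by omega
  have hr3 : 3 * r ≤ N := three_mul_le_of_hyp ht hΔ hH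
  -- the number of outcomes
  set Q : ℕ := Fintype.card (DPair N × DPair N) with hQ
  have hcardΩ : Fintype.card (Outcome N m) = Q ^ m := by
    rw [Fintype.card_fun, Fintype.card_fin]
  have hD : Fintype.card (DPair N) = N * N - N := by
    unfold DPair
    rw [Fintype.card_subtype_compl, Fintype.card_prod, Fintype.card_fin]
    congr 1
    -- pairs with equal coordinates ↔ the diagonal
    rw [Fintype.card_subtype]
    have : (univ.filter fun p : Fin N × Fin N => p.1 = p.2) = (univ : Finset (Fin N)).image fun a => (a, a) := by
      ext p
      simp only [Finset.mem_filter, Finset.mem_univ, true_and, Finset.mem_image]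
      constructor
      · intro h; exact ⟨p.1, by rw [Prod.ext_iff]; exact ⟨rfl, h⟩⟩
      · rintro ⟨a, rfl⟩; rfl
    rw [this, Finset.card_image_of_injective _ (fun a b h => (Prod.ext_iff.1 h).1), Finset.card_univ,
      Fintype.card_fin]
  have hQpos : (0 : ℝ) < Q := by
    have : 0 < Q := by
      rw [hQ, Fintype.card_prod, hD]
      have : 2 ≤ N * N - N := by
        have : N + 2 ≤ N * N := by nlinarith
        omega
      positivity
    exact_mod_cast this
  have hQge : (4 : ℝ) * (N : ℝ) ^ 4 ≤ 16 * Q := by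
    have h1 : (Q : ℝ) = ((N * N - N : ℕ) : ℝ) ^ 2 := by
      rw [hQ, Fintype.card_prod, hD]; push_cast; ring
    have h2 : ((N * N - N : ℕ) : ℝ) = (N : ℝ) * N - N := by
      rw [Nat.cast_sub (Nat.le_mul_self N)]; push_cast; ring
    rw [h1, h2]
    have hN2 : (2 : ℝ) ≤ N := by exact_mod_cast hN
    nlinarith [sq_nonneg ((N : ℝ) * N - 2 * N), mul_nonneg (sub_nonneg.2 hN2) (sq_nonneg (N : ℝ))]
  -- the union bound, term by term
  have hub := card_badSetT_le (m := m) ht1 r hr3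
  refine lt_of_le_of_lt hub ?_
  rw [hcardΩ]
  push_cast
  have hterm : ∀ i ∈ Finset.range r,
      (m.choose (i + 1) : ℝ) * ((N + N).choose (vT t (i + 1)) : ℝ) * (((vT t (i + 1) : ℕ) : ℝ) ^ 4 / 16) ^ (i + 1) *
          (Q : ℝ) ^ (m - (i + 1)) ≤ (1 / 2) ^ (i + 1) * (Q : ℝ) ^ m := by
    intro i hi
    rw [Finset.mem_range] at hi
    have hHf : (1944 * Δ) ^ (2 * t) * (3 * (i + 1)) ^ (t - 1) ≤ N ^ (t - 1) :=
      le_trans (Nat.mul_le_mul_left _ (Nat.pow_le_pow_left (by omega) _)) hH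
    have h3f : 3 * (i + 1) ≤ N := by omega
    have hsm : i + 1 ≤ m ∨ m < i + 1 := le_or_gt _ _
    have ht := termT_le t Δ N (i + 1) m ht1 (by omega) hm hHf h3f
    -- compare (v⁴/16)^s Q^{m-s} with (v⁴/(4N⁴))^s Q^m
    rcases hsm with hsm | hsm
    · have hQsplit : (Q : ℝ) ^ m = (Q : ℝ) ^ (i + 1) * (Q : ℝ) ^ (m - (i + 1)) := by
        rw [← pow_add]; congr 1; omega
      rw [hQsplit]
      have hstep : (((vT t (i + 1) : ℕ) : ℝ) ^ 4 / 16) ^ (i + 1) ≤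
          (((vT t (i + 1) : ℕ) : ℝ) ^ 4 / (4 * (N : ℝ) ^ 4)) ^ (i + 1) * (Q : ℝ) ^ (i + 1) := by
        rw [← mul_pow]
        refine pow_le_pow_left₀ (by positivity) ?_ _
        rw [div_mul_eq_mul_div, div_le_div_iff₀ (by norm_num) (by positivity)]
        have h0 : (0 : ℝ) ≤ ((vT t (i + 1) : ℕ) : ℝ) ^ 4 := by positivity
        nlinarith
      have hQm : (0 : ℝ) ≤ (Q : ℝ) ^ (m - (i + 1)) := by positivity
      have hcc : (0 : ℝ) ≤ (m.choose (i + 1) : ℝ) * ((N + N).choose (vT t (i + 1)) : ℝ) := by positivity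
      calc (m.choose (i + 1) : ℝ) * ((N + N).choose (vT t (i + 1)) : ℝ) *
            (((vT t (i + 1) : ℕ) : ℝ) ^ 4 / 16) ^ (i + 1) * (Q : ℝ) ^ (m - (i + 1))
          ≤ (m.choose (i + 1) : ℝ) * ((N + N).choose (vT t (i + 1)) : ℝ) *
            ((((vT t (i + 1) : ℕ) : ℝ) ^ 4 / (4 * (N : ℝ) ^ 4)) ^ (i + 1) * (Q : ℝ) ^ (i + 1)) *
              (Q : ℝ) ^ (m - (i + 1)) := by
            exact mul_le_mul_of_nonneg_right (mul_le_mul_of_nonneg_left hstep hcc) hQm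
        _ = ((m.choose (i + 1) : ℝ) * ((N + N).choose (vT t (i + 1)) : ℝ) *
            (((vT t (i + 1) : ℕ) : ℝ) ^ 4 / (4 * (N : ℝ) ^ 4)) ^ (i + 1)) *
              ((Q : ℝ) ^ (i + 1) * (Q : ℝ) ^ (m - (i + 1))) := by ring
        _ ≤ (1 / 2) ^ (i + 1) * ((Q : ℝ) ^ (i + 1) * (Q : ℝ) ^ (m - (i + 1))) :=
            mul_le_mul_of_nonneg_right ht (by positivity)
    · -- `m < s`: the binomial `C(m, s)` vanishes
      rw [Nat.choose_eq_zero_of_lt hsm]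
      simp only [Nat.cast_zero, zero_mul]
      positivity
  refine (Finset.sum_le_sum hterm).trans_lt ?_
  rw [← Finset.sum_mul]
  have hQm : (0 : ℝ) < (Q : ℝ) ^ m := by positivity
  calc (∑ i ∈ Finset.range r, (1 / 2 : ℝ) ^ (i + 1)) * (Q : ℝ) ^ m < 1 * (Q : ℝ) ^ m :=
        mul_lt_mul_of_pos_right (geom_half_lt_one r) hQm
    _ = (Q : ℝ) ^ m := one_mul _

/-- **A good outcome exists** (same hypotheses). -/
theorem exists_goodT (t Δ N r : ℕ) (ht : 2 ≤ t) (hΔ : 1 ≤ Δ) (hN : 2 ≤ N)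
    (hH : (1944 * Δ) ^ (2 * t) * (3 * r) ^ (t - 1) ≤ N ^ (t - 1)) :
    ∃ ω : Outcome N (Δ * (N + N)), ¬badT t r ω := by
  classical
  by_contra h
  push Not at h
  have hall : badSetT N (Δ * (N + N)) t r = univ := by
    ext ω; simp [badSetT, h ω]
  have := card_badSetT_lt t Δ N r ht hΔ hN hH
  rw [hall, Finset.card_univ] at this
  exact lt_irrefl _ this

/-- **T23.1-B — density-uniform boundary expansion for typed pure `P⋆`** (closes `SASubThreshold.PstarExpandingDensity` by
name), with `c = 1944^{2t}·6^{t−1}`. -/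
theorem pstarExpandingDensity : SASubThreshold.PstarExpandingDensity := by
  classical
  intro t ht
  refine ⟨1944 ^ (2 * t) * 6 ^ (t - 1), by positivity, fun Δ N₀ hΔ => ?_⟩
  set N := max N₀ 2 with hNdef
  have hN2 : 2 ≤ N := le_max_right _ _
  have h0 : (1944 * Δ) ^ (2 * t) * (3 * 0) ^ (t - 1) ≤ N ^ (t - 1) := by
    rw [mul_zero, zero_pow (by omega), mul_zero]
    exact Nat.zero_le _
  have hr₀P : (1944 * Δ) ^ (2 * t) * (3 * Nat.findGreatest
      (fun r => (1944 * Δ) ^ (2 * t) * (3 * r) ^ (t - 1) ≤ N ^ (t - 1)) N) ^ (t - 1) ≤ N ^ (t - 1) :=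
    Nat.findGreatest_spec (P := fun r => (1944 * Δ) ^ (2 * t) * (3 * r) ^ (t - 1) ≤ N ^ (t - 1)) (Nat.zero_le N) h0
  obtain ⟨ω, hω⟩ := exists_goodT t Δ N _ ht hΔ hN2 hr₀P
  refine ⟨N + N, le_trans (le_max_left N₀ 2) (Nat.le_add_right N N), inst ω, isPure_inst ω, typed_inst ω, fun r hr => ?_⟩
  have hH : (1944 * Δ) ^ (2 * t) * (3 * r) ^ (t - 1) ≤ N ^ (t - 1) := by
    have e1 : 1944 ^ (2 * t) * 6 ^ (t - 1) * Δ ^ (2 * t) * r ^ (t - 1) =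
        (1944 * Δ) ^ (2 * t) * (3 * r) ^ (t - 1) * 2 ^ (t - 1) := by
      rw [show (6 : ℕ) = 3 * 2 from rfl, mul_pow, mul_pow, mul_pow]
      ring
    have e2 : (N + N) ^ (t - 1) = N ^ (t - 1) * 2 ^ (t - 1) := by
      rw [← mul_pow, Nat.mul_two]
    rw [e1, e2] at hr
    exact Nat.le_of_mul_le_mul_right hr (by positivity)
  have hrN : r ≤ N := by
    have := three_mul_le_of_hyp ht hΔ hH
    omega
  have hrr₀ : r ≤ Nat.findGreatest (fun r => (1944 * Δ) ^ (2 * t) * (3 * r) ^ (t - 1) ≤ N ^ (t - 1)) N :=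
    Nat.le_findGreatest hrN hH
  exact boundaryExpandingQ_of_not_badT t r ω fun hb => hω (badT_mono hrr₀ hb)

end Summit.PneNP.PneNP.Theorems.PstarDensityExist
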